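import Summits.ResolutionOfSingularities.ResolutionOfSingularities.Theorems.FrobeniusClosingPatchingRelPerfectCrossingLinesSurfaceStep
import HarnessLib

/-!
# Crux `PatchingRelPerfect` (stmt-ResolutionOfSingularities-16161), chain W5.2 — the CROSSING-LINES
# member `I = (x₀x₁ + x₂x₃, x₃²) + 𝔪⁴`, part 3a: chart algebra of the LINE STEP at the crossing

[OURS · L1 W5.2 · kernel certificate, res-L1-w52-plan-1 NAMING 2026-08-27T17:00:47Z (O2′)]
Level 1 of the hand tower on the chart of `x₂` of `Bl_𝔪` (`u = x₂` the exceptional parameter,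
`a = x₀/x₂`, `b = x₁/x₂`, `p = x₃/x₂`, host `w = a b + p`, the strict transform of the quadric
`x₀x₁ + x₂x₃`).  The residual of the member is `K = (w) + (p²) + (u²)`, of order `1`, with
cosupport `V(u, p, a b)` = the two LINES `L₀ = V(u, a, w)` and `L₁ = V(u, b, w)` of `E`
crossing at the origin.  The S-avatars arrive on this chart as

  `C = (a, p, u)` (`= 𝓘_{L₀}`), `D = (p, u)`, `J₁ = (w) + C²` (avatar of the surface `S₁`),
  `A₁ = (w) + C·D` (avatar of `L₀ ∪ L₁`, then of `L₁′`, then of `L₁″`),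
  `T₁ = (w)·C² + A₁²` (avatar of the surface `S₂`).

THIS FILE (pure ideal algebra over any commutative ring, plus one blow-up lemma):

* the images of `K, J₁, A₁, T₁` on the three charts of `Bl_C` (`aChart_*`, `uChart_*`, `wChart_*`,
  `map_*`, `collect_*`), including the flat form `B₂_flat` of the avatar of `S₂` used by part 2;
* `CrossingLines.chartGen_mem_nonZeroDivisors` — a chart generator `x_j/x_i` is a
  non-zero-divisor when `x_j` is;
* `CrossingLines.isRegular_of_isBlowup_pair_pow` — blowing up a power `Nᵏ⁺¹` of a regular
  codimension-two centre `N = (g, w)` of a regular ring is regular.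

Fact-free; nothing here is a statement of the manuscript under review (AI-written; AI review
weaker than expert review).

## References

* Q. Liu, *Algebraic Geometry and Arithmetic Curves*, OUP 2002, Thm. 8.1.19 (a). [Liu2002]
* The Stacks Project, Tags 080A, 080B, 0804, 0BIQ. [StacksProject]
* U. Görtz, T. Wedhorn, *Algebraic Geometry I* (2nd ed., 2020), Prop. 13.91 (4), 13.96 (2). [GortzWedhorn2020]
-/

-- `Summit.<Summit>.<Sub>.Theorems` with `Sub = Summit` (single-conjunct summit, D-0017)
set_option linter.dupNamespace false

noncomputable section

open CategoryTheory CategoryTheory.Limits AlgebraicGeometry Literature.AlgebraicGeometry.Resolution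
open scoped Pointwise nonZeroDivisors

namespace Summit.ResolutionOfSingularities.ResolutionOfSingularities.Theorems

universe u

namespace CrossingLines

open CuspMember TwoQuadric

/-! ## Ideal algebra of the three charts of `Bl_C`, `C = (u, a, w)` (any commutative ring) -/

section Algebra

variable {A : Type u} [CommRing A]

omit [CommRing A] in
/-- `![p, q, r] ∘ (1 2) = ![p, r, q]`. [folklore] -/
theorem vec3_swap12 (p q r : A) : (![p, q, r] : Fin 3 → A) ∘ (Equiv.swap (1 : Fin 3) 2) = ![p, r, q] := by
  funext k
  fin_cases k <;> rfl

/-- A chart generator `e_j = x_j / x_i` is a non-zero-divisor when `x_j` is (`x_j/1 = (x_i/1) e_j`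
and `x_j/1` is a non-zero-divisor, GW Prop. 13.91 (4)). [cite: GortzWedhorn2020, Prop. 13.91 (4) (proof)] -/
theorem chartGen_mem_nonZeroDivisors {n : ℕ} (x : Fin n → A) (i j : Fin n) (hj : x j ∈ A⁰) :
    chartGen x i j ∈ (chartRing x i)⁰ := by
  have h : chartBase x i (x j) ∈ (chartRing x i)⁰ :=
    reesChartBase_mem_nonZeroDivisors_of_mem_nonZeroDivisors (I := Ideal.span (Set.range x)) (x i)
      (Ideal.mem_span_range_self (f := x) (x := i)) hj
  rw [reesChartBase_apply_eq_mul_chartGen x i j] at h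
  exact mem_nonZeroDivisors_of_mul_mem h

/-- The centre: `(a) + (p) + (u) = (u, a, a b + p)`. [folklore] -/
theorem centre_eq (u a b p : A) :
    Ideal.span {a} ⊔ Ideal.span {p} ⊔ Ideal.span {u} = Ideal.span (Set.range ![u, a, a * b + p]) := by
  rw [span_range_vec3, sup_span_congr_of_sub_mem (Ideal.span {a}) (y := p) (z := a * b + p)
    (Ideal.mem_span_singleton'.mpr ⟨-b, by ring⟩)]
  ac_rfl

/-- `(X ⊔ Y)² = X² ⊔ X Y ⊔ Y²` for ideals. [folklore] -/
theorem sup_sq (X Y : Ideal A) : (X ⊔ Y) ^ 2 = X ^ 2 ⊔ X * Y ⊔ Y ^ 2 := by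
  rw [sq, sq, sq, Ideal.sup_mul, Ideal.mul_sup, Ideal.mul_sup, mul_comm Y X]
  apply le_antisymm
  · exact sup_le (sup_le (le_sup_of_le_left le_sup_left) (le_sup_of_le_left le_sup_right))
      (sup_le (le_sup_of_le_left le_sup_right) le_sup_right)
  · exact sup_le (sup_le (le_sup_of_le_left le_sup_left) (le_sup_of_le_left le_sup_right))
      (le_sup_of_le_right le_sup_right)

/-! ### `a`-chart (`a = g`, `u = g u′`, `w = g w′`, `p = g (w′ - b)`) -/

/-- `K ↦ g · K₁`, `K₁ = (w′) + (g b²) + (g u′²)`. [folklore] -/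
theorem aChart_K (g w b u : A) :
    Ideal.span {g * w} ⊔ Ideal.span {(g * (w - b)) ^ 2} ⊔ Ideal.span {(g * u) ^ 2} =
      Ideal.span {g} * (Ideal.span {w} ⊔ Ideal.span {g * b ^ 2} ⊔ Ideal.span {g * u ^ 2}) := by
  rw [sup_span_congr_of_sub_mem (Ideal.span {g * w}) (y := (g * (w - b)) ^ 2) (z := g * (g * b ^ 2))
    (Ideal.mem_span_singleton'.mpr ⟨g * w - 2 * g * b, by ring⟩),
    show (g * u) ^ 2 = g * (g * u ^ 2) by ring, Ideal.mul_sup, Ideal.mul_sup,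
    Ideal.span_singleton_mul_span_singleton, Ideal.span_singleton_mul_span_singleton,
    Ideal.span_singleton_mul_span_singleton]

/-- `J₁ ↦ g · N`, `N = (w′) + (g)`. [folklore] -/
theorem aChart_J (g w : A) :
    Ideal.span {g * w} ⊔ Ideal.span {g} ^ 2 = Ideal.span {g} * (Ideal.span {w} ⊔ Ideal.span {g}) := by
  rw [sq, Ideal.mul_sup, Ideal.span_singleton_mul_span_singleton, Ideal.span_singleton_mul_span_singleton]

/-- `A₁ ↦ g · A₂`, `A₂ = (w′) + (g b) + (g u′)`. [folklore] -/
theorem aChart_A (g w b u : A) :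
    Ideal.span {g * w} ⊔ Ideal.span {g} * (Ideal.span {g * (w - b)} ⊔ Ideal.span {g * u}) =
      Ideal.span {g} * (Ideal.span {w} ⊔ Ideal.span {g * b} ⊔ Ideal.span {g * u}) := by
  rw [Ideal.mul_sup, Ideal.mul_sup, Ideal.mul_sup]
  simp only [Ideal.span_singleton_mul_span_singleton]
  rw [← sup_assoc,
    sup_span_congr_of_sub_mem (Ideal.span {g * w}) (y := g * (g * (w - b))) (z := -(g * (g * b)))
      (Ideal.mem_span_singleton'.mpr ⟨g, by ring⟩), Ideal.span_singleton_neg]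

/-- `T₁ ↦ g² · ((w′)(g) + P²)` for `A₁ ↦ g · P`. [folklore] -/
theorem aChart_T (g w : A) (P : Ideal A) :
    Ideal.span {g * w} * Ideal.span {g} ^ 2 ⊔ (Ideal.span {g} * P) ^ 2 =
      Ideal.span {g ^ 2} * (Ideal.span {w} * Ideal.span {g} ⊔ P ^ 2) := by
  rw [← Ideal.span_singleton_mul_span_singleton, ← Ideal.span_singleton_pow, ← Submodule.add_eq_sup,
    ← Submodule.add_eq_sup]
  ring

/-- **The flat form of `B₂`**: `(w)(g) + ((w) + (g b) + (g u))² = (w², w g) + g² (b², u b, u²)`.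
[folklore] -/
theorem B₂_flat (w g b u : A) :
    Ideal.span {w} * Ideal.span {g} ⊔ (Ideal.span {w} ⊔ Ideal.span {g * b} ⊔ Ideal.span {g * u}) ^ 2 =
      Ideal.span {w ^ 2} ⊔ Ideal.span {w * g} ⊔ Ideal.span {g ^ 2 * b ^ 2} ⊔
        Ideal.span {g ^ 2 * (u * b)} ⊔ Ideal.span {g ^ 2 * u ^ 2} := by
  rw [sup_sq, sup_sq, Ideal.sup_mul]
  simp only [Ideal.span_singleton_pow, Ideal.span_singleton_mul_span_singleton]
  rw [show (g * b) ^ 2 = g ^ 2 * b ^ 2 by ring, show g * b * (g * u) = g ^ 2 * (u * b) by ring,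
    show (g * u) ^ 2 = g ^ 2 * u ^ 2 by ring]
  -- kill `(w g b)` and `(w g u)` with `(w g)`, then reorder
  have h1 : Ideal.span {w * (g * b)} ≤ Ideal.span {w * g} :=
    Ideal.span_singleton_le_span_singleton.mpr ⟨b, by ring⟩
  have h2 : Ideal.span {w * (g * u)} ≤ Ideal.span {w * g} :=
    Ideal.span_singleton_le_span_singleton.mpr ⟨u, by ring⟩
  apply le_antisymm
  · refine sup_le (le_sup_of_le_left (le_sup_of_le_left (le_sup_of_le_left le_sup_right))) ?_
    refine sup_le (sup_le (sup_le (sup_le ?_ ?_) ?_) (sup_le ?_ ?_)) ?_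
    · exact le_sup_of_le_left (le_sup_of_le_left (le_sup_of_le_left le_sup_left))
    · exact h1.trans (le_sup_of_le_left (le_sup_of_le_left (le_sup_of_le_left le_sup_right)))
    · exact le_sup_of_le_left (le_sup_of_le_left le_sup_right)
    · exact h2.trans (le_sup_of_le_left (le_sup_of_le_left (le_sup_of_le_left le_sup_right)))
    · exact le_sup_of_le_left le_sup_right
    · exact le_sup_right
  · refine sup_le (sup_le (sup_le (sup_le ?_ le_sup_left) ?_) ?_) ?_
    · exact le_sup_of_le_right (le_sup_of_le_left (le_sup_of_le_left (le_sup_of_le_left le_sup_left)))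
    · exact le_sup_of_le_right (le_sup_of_le_left (le_sup_of_le_left le_sup_right))
    · exact le_sup_of_le_right (le_sup_of_le_left (le_sup_of_le_right le_sup_right))
    · exact le_sup_of_le_right le_sup_right

/-- Collecting on the `a`-chart: `(gK)(gN)(gA)(g²B) = g⁵ · ((K A B) N)`. [folklore] -/
theorem collect_aChart (g : A) (K N P B : Ideal A) :
    Ideal.span {g} * K * (Ideal.span {g} * N) * (Ideal.span {g} * P) * (Ideal.span {g ^ 2} * B) =
      Ideal.span {g ^ 5} * ((K * P * B) * N) := by
  rw [← Ideal.span_singleton_pow, ← Ideal.span_singleton_pow]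
  ring

/-! ### `u`-chart (`u = g`, `a = g a′`, `w = g w′`, `p = g (w′ - a′ b)`) -/

/-- `A₁ ↦ g · N`. [folklore] -/
theorem uChart_A (g w c : A) :
    Ideal.span {g * w} ⊔ Ideal.span {g} * (Ideal.span {g * c} ⊔ Ideal.span {g}) =
      Ideal.span {g} * (Ideal.span {w} ⊔ Ideal.span {g}) := by
  rw [Ideal.mul_sup, Ideal.mul_sup, Ideal.span_singleton_mul_span_singleton,
    Ideal.span_singleton_mul_span_singleton, Ideal.span_singleton_mul_span_singleton, ← sup_assoc,
    sup_span_sup_span_of_dvd' _ (⟨c, by ring⟩ : g * g ∣ g * (g * c))]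

/-- `(w)(g) + N² = N²`, `N = (w, g)`. [folklore] -/
theorem absorb_N (w g : A) :
    Ideal.span {w} * Ideal.span {g} ⊔ (Ideal.span {w} ⊔ Ideal.span {g}) ^ 2 =
      (Ideal.span {w} ⊔ Ideal.span {g}) ^ 2 := by
  rw [sq]
  exact sup_eq_right.mpr (Ideal.mul_mono le_sup_left le_sup_right)

/-- Collecting on the `u`-chart: `(gN)(gN)(gN)(g²N²) = g⁵ · N⁵`. [folklore] -/
theorem collect_uChart (g : A) (N : Ideal A) :
    Ideal.span {g} * N * (Ideal.span {g} * N) * (Ideal.span {g} * N) * (Ideal.span {g ^ 2} * N ^ 2) =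
      Ideal.span {g ^ 5} * N ^ 5 := by
  rw [← Ideal.span_singleton_pow, ← Ideal.span_singleton_pow]
  ring

/-! ### `w`-chart (`w = g`, `u = g u′`, `a = g a′`, `p = g (1 - a′ b)`) -/

/-- `J₁ ↦ (g)`. [folklore] -/
theorem wChart_J (g : A) : Ideal.span {g} ⊔ Ideal.span {g} ^ 2 = Ideal.span {g} := by
  rw [sq, Ideal.span_singleton_mul_span_singleton]
  exact span_sup_eq ⟨g, rfl⟩

/-- `A₁ ↦ (g)`. [folklore] -/
theorem wChart_A (g : A) (X : Ideal A) : Ideal.span {g} ⊔ Ideal.span {g} * X = Ideal.span {g} :=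
  sup_eq_left.mpr Ideal.mul_le_right

/-- `T₁ ↦ (g²)`. [folklore] -/
theorem wChart_T (g : A) :
    Ideal.span {g} * Ideal.span {g} ^ 2 ⊔ Ideal.span {g} ^ 2 = Ideal.span {g ^ 2} := by
  rw [Ideal.span_singleton_pow, Ideal.span_singleton_mul_span_singleton]
  exact sup_span_eq ⟨g, by ring⟩

/-! ### Images of the residual factors under a ring map -/

variable {C : Type u} [CommRing C] (φ : A →+* C) (w u p : A) (M : Ideal A) (g : C)

/-- Image of `K = (w) + (p²) + (u²)`. [folklore] -/
theorem map_K : (Ideal.span {w} ⊔ Ideal.span {p ^ 2} ⊔ Ideal.span {u ^ 2}).map φ =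
    Ideal.span {φ w} ⊔ Ideal.span {φ p ^ 2} ⊔ Ideal.span {φ u ^ 2} := by
  simp only [Ideal.map_sup, map_span_singleton, map_pow]

/-- Image of `J₁ = (w) + M²` when `M ↦ (g)`. [folklore] -/
theorem map_J (hM : M.map φ = Ideal.span {g}) :
    (Ideal.span {w} ⊔ M ^ 2).map φ = Ideal.span {φ w} ⊔ Ideal.span {g} ^ 2 := by
  rw [Ideal.map_sup, map_span_singleton, Ideal.map_pow, hM]

/-- Image of `A₁ = (w) + M · ((p) + (u))` when `M ↦ (g)`. [folklore] -/
theorem map_A (hM : M.map φ = Ideal.span {g}) :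
    (Ideal.span {w} ⊔ M * (Ideal.span {p} ⊔ Ideal.span {u})).map φ =
      Ideal.span {φ w} ⊔ Ideal.span {g} * (Ideal.span {φ p} ⊔ Ideal.span {φ u}) := by
  rw [Ideal.map_sup, Ideal.map_mul, Ideal.map_sup, map_span_singleton, map_span_singleton,
    map_span_singleton, hM]

/-- Image of `T₁ = (w)·M² + A₁²` when `M ↦ (g)`. [folklore] -/
theorem map_T (hM : M.map φ = Ideal.span {g}) :
    (Ideal.span {w} * M ^ 2 ⊔ (Ideal.span {w} ⊔ M * (Ideal.span {p} ⊔ Ideal.span {u})) ^ 2).map φ =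
      Ideal.span {φ w} * Ideal.span {g} ^ 2 ⊔
        (Ideal.span {φ w} ⊔ Ideal.span {g} * (Ideal.span {φ p} ⊔ Ideal.span {φ u})) ^ 2 := by
  rw [Ideal.map_sup, Ideal.map_mul, Ideal.map_pow, Ideal.map_pow, map_A φ w u p M g hM,
    map_span_singleton, hM]

end Algebra

/-! ## Blowing up a power of a regular codimension-two centre -/

section PairPow

variable {B : Type u} [CommRing B] [IsRegularRing B] (g w : B)

/-- **Every blowing up of `Spec B` along `Nᵏ⁺¹`, `N = (g, w)` quasi-regular with `B/N`
regular (`B` regular), is a regular scheme**: it is `Bl_N` (regular, Stacks 0BIQ / Liu 8.1.19 (a))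
followed by the blowing up of the Cartier divisor `Nᵏ · 𝒪`.
[cite: Liu2002, Thm. 8.1.19 (a)] [cite: StacksProject, Tag 080A] -/
theorem isRegular_of_isBlowup_pair_pow (k : ℕ) (hq : IsQuasiRegular (![g, w] : Fin 2 → B))
    (hreg : IsRegularRing (B ⧸ Ideal.span (Set.range (![g, w] : Fin 2 → B))))
    {Y : Scheme.{u}} {ρ : Y ⟶ Spec (.of B)}
    (hρ : IsBlowup ρ (affineBlowup.idealSheaf ((Ideal.span {g} ⊔ Ideal.span {w}) ^ (k + 1)))) :
    Scheme.IsRegular Y := by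
  rw [← span_range_vec2 g w, pow_succ] at hρ
  haveI := hreg
  refine isRegular_of_isBlowup_mul_of_charts (![g, w] : Fin 2 → B) _ (fun l Y' ρ' hρ' => ?_) hρ
  haveI hBl : IsRegularRing (chartRing (![g, w] : Fin 2 → B) l) := isRegularRing_blowupChart _ l hq
  rw [Ideal.map_pow, map_reesChartBase_eq ((![g, w] : Fin 2 → B) l)
    (Ideal.mem_span_range_self (f := (![g, w] : Fin 2 → B)) (x := l)), Ideal.span_singleton_pow] at hρ'
  exact isRegular_of_isBlowup_span_singleton_nzd
    (pow_mem (reesChartBase_mem_nonZeroDivisors ((![g, w] : Fin 2 → B) l)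
      (Ideal.mem_span_range_self (f := (![g, w] : Fin 2 → B)) (x := l))) k) hρ'

end PairPow

end CrossingLines

end Summit.ResolutionOfSingularities.ResolutionOfSingularities.Theorems

end
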